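import Summits.ValiantsHypothesis.ValiantsHypothesis.Theorems.LacunarySymmetroidMatrixDescartesCensusLorentzRows

/-!
# `MatrixDescartes` census — END-PAIR RESIDUAL IDENTITIES: the rank rows of a real symmetric `2 × 2` pencil in completed-square form

HONEST FRAMING.  Object-search cell `pub-symmetroid`, door-A item `Theses.LacunarySymmetroid.DoorA26 = PosRootLawAt 2 6 19`
(stmt-ValiantsHypothesis-19979; OPEN, typed, never asserted).  Pure algebra, valid for EVERY real symmetric `2 × 2` pencil on every support
(helper rows for the census line's hard chambers; nothing here is about roots, about `ζ_sym(2,6)`, about `MatrixDescartes` or about `VP ≠ VNP`).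

For symmetric letters `S = [[a,b],[b,c]]` write `q(S) = ac − b²` and `β(S,T) = ac' + ca' − 2bb'` (`= 2B(S,T)`, `B` the polar form of `det`,
so that the coefficients of `det (∑ X^{d_l} S_l)` are the `q`'s and `β`'s).  Fix a PAIR of letters `P, Q` and put `D := β(P,Q)² − 4 q(P) q(Q)`
(`> 0` iff `P, Q` span a Lorentzian plane of `(Sym₂ℝ, det) ≅ ℝ^{1,2}`; always so for two linearly independent definite letters).  For any further letters
`S_i, S_j, S_k` define the END-PAIR RESIDUALS
* `U_i := 4 q_P q_Q q_i + β_PQ β_Qi β_Pi − q_P β_Qi² − q_Q β_Pi² − q_i β_PQ²` — half the `3 × 3` Gram-shaped determinant of `(P, Q, S_i)`;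
  it is a SQUARE, hence `≥ 0`, by the tree's `Census.gram_three_eq_sq` (row family G3);
* `W_ij := D·β_ij + 2 q_Q β_Pi β_Pj − β_PQ (β_Pi β_Qj + β_Qi β_Pj) + 2 q_P β_Qi β_Qj` — `D` times the `(i,j)` entry of the Schur complement of the
  `{P,Q}` block in the Gram-shaped matrix (and `W_ii = −2 U_i`).
Because six vectors of `ℝ^{1,2}` have a Gram matrix of rank `≤ 3`, that Schur complement is the Gram matrix of the projections onto the (negative
definite) line orthogonal to `span(P,Q)`, i.e. `−s sᵀ` of RANK ONE.  In coordinates this is the pair of polynomial identities proved here: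
`W_ij² = 4 U_i U_j` (`endPair_residual_sq`) and `W_ij W_ik = −2 U_i W_jk` (`endPair_residual_mul`) — the `4 × 4` and `5 × 5` rank rows in
COMPLETED-SQUARE form.  Motivation (val-sym-door-p1 g10, report `HOME/DOOR-A-P1-REPORT-val-sym-door-p1.md` rev 12 §50–§51, located): on the
C25-immune cells the near-extremal rank-3 points are «two-tower» configurations in which the three large terms of every `4 × 4` minor through the two
end letters CANCEL, so single-term M4-domination rows are silent; these identities are the exact two-sided replacement (after a domination split on the
few terms of `U` and `W` they read `2·log|W_ij| = log U_i + log U_j`).  Proof route: an identity for the ABSTRACT Gram-shaped `4 × 4` determinant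
resp. `5 × 5` minor in free variables (`D · det = W² − 4UU`, `D · minor = W W + 2 U W`, by `ring`), and the vanishing of that determinant / minor on
actual `2 × 2` letters (by `ring`: Cauchy–Binet for four resp. five vectors in a three-space).

[folklore] Elementary linear algebra of Gram matrices in `ℝ^{1,2}` (Schur complement of a nonsingular `2 × 2` block; Cauchy–Binet); no citation needed.
-/

-- `Summit.ValiantsHypothesis.ValiantsHypothesis.…` repeats a component by the D-0017 layout
-- (single-conjunct summit), which the `dupNamespace` linter flags; the name is mandated.
set_option linter.dupNamespace false

namespace Summit.ValiantsHypothesis.ValiantsHypothesis.Theorems.LacunarySymmetroidMatrixDescartes.Census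

/-- **Abstract Schur identity, four letters.**  For FREE real numbers `q_P, q_Q, q_i, q_j` and `β_PQ, …, β_ij`, the Gram-shaped symmetric matrix
`Ĝ = [[2q_P, β_PQ, β_Pi, β_Pj], [β_PQ, 2q_Q, β_Qi, β_Qj], [β_Pi, β_Qi, 2q_i, β_ij], [β_Pj, β_Qj, β_ij, 2q_j]]` satisfies
`D · det Ĝ = W_ij² − 4 U_i U_j` with `D = β_PQ² − 4q_Pq_Q` and the end-pair residuals `U`, `W` of the module docstring (the determinant is
written out by the Leibniz formula). [folklore] -/
theorem gram_four_schur_identity (qP qQ qi qj bPQ bPi bPj bQi bQj bij : ℝ) :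
    (bPQ ^ 2 - 4 * qP * qQ) *
      (2 * qP * 2 * qQ * 2 * qi * 2 * qj - 2 * qP * 2 * qQ * bij * bij - 2 * qP * bQi * bQi * 2 * qj + 2 * qP * bQi * bij * bQj + 2 * qP * bQj * bQi * bij - 2 * qP * bQj * 2 * qi * bQj - bPQ * bPQ * 2 * qi * 2 * qj + bPQ * bPQ * bij * bij + bPQ * bQi * bPi * 2 * qj - bPQ * bQi * bij * bPj - bPQ * bQj * bPi * bij + bPQ * bQj * 2 * qi * bPj + bPi * bPQ * bQi * 2 * qj - bPi * bPQ * bij * bQj - bPi * 2 * qQ * bPi * 2 * qj + bPi * 2 * qQ * bij * bPj + bPi * bQj * bPi * bQj - bPi * bQj * bQi * bPj - bPj * bPQ * bQi * bij + bPj * bPQ * 2 * qi * bQj + bPj * 2 * qQ * bPi * bij - bPj * 2 * qQ * 2 * qi * bPj - bPj * bQi * bPi * bQj + bPj * bQi * bQi * bPj)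
    = ((bPQ ^ 2 - 4 * qP * qQ) * bij + 2 * qQ * bPi * bPj - bPQ * (bPi * bQj + bQi * bPj) + 2 * qP * bQi * bQj) ^ 2 - 4 * (4 * qP * qQ * qi + bPQ * bQi * bPi - qP * bQi ^ 2 - qQ * bPi ^ 2 - qi * bPQ ^ 2) * (4 * qP * qQ * qj + bPQ * bQj * bPj - qP * bQj ^ 2 - qQ * bPj ^ 2 - qj * bPQ ^ 2) := by
  ring

/-- **Cauchy–Binet, four letters.**  For four real symmetric `2 × 2` matrices `P = [[a,b],[b,c]]`, `Q = [[a',b'],[b',c']]`, `S_i = [[x,y],[y,z]]`,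
`S_j = [[x',y'],[y',z']]` the Gram-shaped `4 × 4` determinant (diagonal `2q`, off-diagonal `β`) VANISHES identically — four vectors in the
three-space `(Sym₂ℝ, det)`. [folklore] -/
theorem gram_four_eq_zero (a b c a' b' c' x y z x' y' z' : ℝ) :
    2 * (a * c - b ^ 2) * 2 * (a' * c' - b' ^ 2) * 2 * (x * z - y ^ 2) * 2 * (x' * z' - y' ^ 2) - 2 * (a * c - b ^ 2) * 2 * (a' * c' - b' ^ 2) * (x * z' + z * x' - 2 * (y * y')) * (x * z' + z * x' - 2 * (y * y')) - 2 * (a * c - b ^ 2) * (a' * z + c' * x - 2 * (b' * y)) * (a' * z + c' * x - 2 * (b' * y)) * 2 * (x' * z' - y' ^ 2) + 2 * (a * c - b ^ 2) * (a' * z + c' * x - 2 * (b' * y)) * (x * z' + z * x' - 2 * (y * y')) * (a' * z' + c' * x' - 2 * (b' * y')) + 2 * (a * c - b ^ 2) * (a' * z' + c' * x' - 2 * (b' * y')) * (a' * z + c' * x - 2 * (b' * y)) * (x * z' + z * x' - 2 * (y * y')) - 2 * (a * c - b ^ 2) * (a' * z' + c' * x' - 2 * (b' * y')) * 2 * (x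 * z - y ^ 2) * (a' * z' + c' * x' - 2 * (b' * y')) - (a * c' + c * a' - 2 * (b * b')) * (a * c' + c * a' - 2 * (b * b')) * 2 * (x * z - y ^ 2) * 2 * (x' * z' - y' ^ 2) + (a * c' + c * a' - 2 * (b * b')) * (a * c' + c * a' - 2 * (b * b')) * (x * z' + z * x' - 2 * (y * y')) * (x * z' + z * x' - 2 * (y * y')) + (a * c' + c * a' - 2 * (b * b')) * (a' * z + c' * x - 2 * (b' * y)) * (a * z + c * x - 2 * (b * y)) * 2 * (x' * z' - y' ^ 2) - (a * c' + c * a' - 2 * (b * b')) * (a' * z + c' * x - 2 * (b' * y)) * (x * z' + z * x' - 2 * (y * y')) * (a * z' + c * x' - 2 * (b * y')) - (a * c' + c * a' - 2 * (b * b')) * (a' * z' + c' * x' - 2 * (b' * y')) * (a * z + c * x - 2 * (b * y)) * (x * z' + z * x' - 2 * (y * y')) + (a * c' + c * a' - 2 * (b * b')) * (a' * z' + c' * x' - 2 * (b' * y')) * 2 * (x * z - y ^ 2) * (a * z' + c * x' - 2 * (b * y')) + (a * z + c * x - 2 * (b * y)) * (a * c' + c * a' - 2 * (b * b')) * (a'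 * z + c' * x - 2 * (b' * y)) * 2 * (x' * z' - y' ^ 2) - (a * z + c * x - 2 * (b * y)) * (a * c' + c * a' - 2 * (b * b')) * (x * z' + z * x' - 2 * (y * y')) * (a' * z' + c' * x' - 2 * (b' * y')) - (a * z + c * x - 2 * (b * y)) * 2 * (a' * c' - b' ^ 2) * (a * z + c * x - 2 * (b * y)) * 2 * (x' * z' - y' ^ 2) + (a * z + c * x - 2 * (b * y)) * 2 * (a' * c' - b' ^ 2) * (x * z' + z * x' - 2 * (y * y')) * (a * z' + c * x' - 2 * (b * y')) + (a * z + c * x - 2 * (b * y)) * (a' * z' + c' * x' - 2 * (b' * y')) * (a * z + c * x - 2 * (b * y)) * (a' * z' + c' * x' - 2 * (b' * y')) - (a * z + c * x - 2 * (b * y)) * (a' * z' + c' * x' - 2 * (b' * y')) * (a' * z + c' * x - 2 * (b' * y)) * (a * z' + c * x' - 2 * (b * y')) - (a * z' + c * x' - 2 * (b * y')) * (a * c' + c * a' - 2 * (b * b')) * (a' * z + c' * x - 2 * (b' * y)) * (x * z' + z * x' - 2 * (y * y')) + (a * z' + c * x' - 2 * (b * y')) * (a * c' + c * a' - 2 *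 (b * b')) * 2 * (x * z - y ^ 2) * (a' * z' + c' * x' - 2 * (b' * y')) + (a * z' + c * x' - 2 * (b * y')) * 2 * (a' * c' - b' ^ 2) * (a * z + c * x - 2 * (b * y)) * (x * z' + z * x' - 2 * (y * y')) - (a * z' + c * x' - 2 * (b * y')) * 2 * (a' * c' - b' ^ 2) * 2 * (x * z - y ^ 2) * (a * z' + c * x' - 2 * (b * y')) - (a * z' + c * x' - 2 * (b * y')) * (a' * z + c' * x - 2 * (b' * y)) * (a * z + c * x - 2 * (b * y)) * (a' * z' + c' * x' - 2 * (b' * y')) + (a * z' + c * x' - 2 * (b * y')) * (a' * z + c' * x - 2 * (b' * y)) * (a' * z + c' * x - 2 * (b' * y)) * (a * z' + c * x' - 2 * (b * y')) = 0 := by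
  ring

/-- **END-PAIR RESIDUAL IDENTITY (square form): `W_ij² = 4 U_i U_j`** for any four real symmetric `2 × 2` letters `P, Q, S_i, S_j` (entries as in
`gram_four_eq_zero`; `U_i = 4q_Pq_Qq_i + β_PQβ_Qiβ_Pi − q_Pβ_Qi² − q_Qβ_Pi² − q_iβ_PQ² ≥ 0` is the G3 square of the tree, `W_ij = Dβ_ij + 2q_Qβ_Piβ_Pj −
β_PQ(β_Piβ_Qj + β_Qiβ_Pj) + 2q_Pβ_Qiβ_Qj`).  Reading: the residual Gram of `S_i, S_j` after the `{P,Q}` block is rank one; as an LP row (after a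
domination split on the terms of `U` and `W`): `2·log|W_ij| = log U_i + log U_j`, two-sided. [folklore] -/
theorem endPair_residual_sq (a b c a' b' c' x y z x' y' z' : ℝ) :
    (((a * c' + c * a' - 2 * (b * b')) ^ 2 - 4 * (a * c - b ^ 2) * (a' * c' - b' ^ 2)) * (x * z' + z * x' - 2 * (y * y')) + 2 * (a' * c' - b' ^ 2) * (a * z + c * x - 2 * (b * y)) * (a * z' + c * x' - 2 * (b * y')) - (a * c' + c * a' - 2 * (b * b')) * ((a * z + c * x - 2 * (b * y)) * (a' * z' + c' * x' - 2 * (b' * y')) + (a' * z + c' * x - 2 * (b' * y)) * (a * z' + c * x' - 2 * (b * y'))) + 2 * (a * c - b ^ 2) * (a' * z + c' * x - 2 * (b' * y)) * (a' * z' + c' * x' - 2 * (b' * y'))) ^ 2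
    = 4 * (4 * (a * c - b ^ 2) * (a' * c' - b' ^ 2) * (x * z - y ^ 2) + (a * c' + c * a' - 2 * (b * b')) * (a' * z + c' * x - 2 * (b' * y)) * (a * z + c * x - 2 * (b * y)) - (a * c - b ^ 2) * (a' * z + c' * x - 2 * (b' * y)) ^ 2 - (a' * c' - b' ^ 2) * (a * z + c * x - 2 * (b * y)) ^ 2 - (x * z - y ^ 2) * (a * c' + c * a' - 2 * (b * b')) ^ 2) * (4 * (a * c - b ^ 2) * (a' * c' - b' ^ 2) * (x' * z' - y' ^ 2) + (a * c' + c * a' - 2 * (b * b')) * (a' * z' + c' * x' - 2 * (b' * y')) * (a * z' + c * x' - 2 * (b * y')) - (a * c - b ^ 2) * (a' * z' + c' * x' - 2 * (b' * y')) ^ 2 - (a' * c' - b' ^ 2) * (a * z' + c * x' - 2 * (b * y')) ^ 2 - (x' * z' - y' ^ 2) * (a * c' + c * a' - 2 * (b * b')) ^ 2) := by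
  have h := gram_four_schur_identity (a * c - b ^ 2) (a' * c' - b' ^ 2) (x * z - y ^ 2) (x' * z' - y' ^ 2) (a * c' + c * a' - 2 * (b * b')) (a * z + c * x - 2 * (b * y)) (a * z' + c * x' - 2 * (b * y')) (a' * z + c' * x - 2 * (b' * y)) (a' * z' + c' * x' - 2 * (b' * y')) (x * z' + z * x' - 2 * (y * y'))
  rw [gram_four_eq_zero, mul_zero] at h
  linarith

/-- **Abstract Schur identity, five letters.**  For FREE real numbers, the `4 × 4` minor of the Gram-shaped `5 × 5` matrix of `(P, Q, S_i, S_j, S_k)`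
with rows `P, Q, i, j` and columns `P, Q, i, k` satisfies `D · minor = W_ij W_ik + 2 U_i W_jk`. [folklore] -/
theorem gram_five_schur_identity (qP qQ qi bPQ bPi bPj bPk bQi bQj bQk bij bik bjk : ℝ) :
    (bPQ ^ 2 - 4 * qP * qQ) *
      (2 * qP * 2 * qQ * 2 * qi * bjk - 2 * qP * 2 * qQ * bik * bij - 2 * qP * bQi * bQi * bjk + 2 * qP * bQi * bik * bQj + 2 * qP * bQk * bQi * bij - 2 * qP * bQk * 2 * qi * bQj - bPQ * bPQ * 2 * qi * bjk + bPQ * bPQ * bik * bij + bPQ * bQi * bPi * bjk - bPQ * bQi * bik * bPj - bPQ * bQk * bPi * bij + bPQ * bQk * 2 * qi * bPj + bPi * bPQ * bQi * bjk - bPi * bPQ * bik * bQj - bPi * 2 * qQ * bPi * bjk + bPi * 2 * qQ * bik * bPj + bPi * bQk * bPi * bQj - bPi * bQk * bQi * bPj - bPk * bPQ * bQi * bij + bPk * bPQ * 2 * qi * bQj + bPk * 2 * qQ * bPi * bij - bPk * 2 * qQ * 2 * qi * bPj - bPk * bQi * bPi * bQj + bPk * bQi * bQi * bPj)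
    = ((bPQ ^ 2 - 4 * qP * qQ) * bij + 2 * qQ * bPi * bPj - bPQ * (bPi * bQj + bQi * bPj) + 2 * qP * bQi * bQj) * ((bPQ ^ 2 - 4 * qP * qQ) * bik + 2 * qQ * bPi * bPk - bPQ * (bPi * bQk + bQi * bPk) + 2 * qP * bQi * bQk) + 2 * (4 * qP * qQ * qi + bPQ * bQi * bPi - qP * bQi ^ 2 - qQ * bPi ^ 2 - qi * bPQ ^ 2) * ((bPQ ^ 2 - 4 * qP * qQ) * bjk + 2 * qQ * bPj * bPk - bPQ * (bPj * bQk + bQj * bPk) + 2 * qP * bQj * bQk) := by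
  ring

/-- **Cauchy–Binet, five letters.**  For five real symmetric `2 × 2` matrices the `4 × 4` minor (rows `P,Q,S_i,S_j`, columns `P,Q,S_i,S_k`) of their
Gram-shaped matrix vanishes identically (`S_k = [[x'',y''],[y'',z'']]`). [folklore] -/
theorem gram_five_minor_eq_zero (a b c a' b' c' x y z x' y' z' x'' y'' z'' : ℝ) :
    2 * (a * c - b ^ 2) * 2 * (a' * c' - b' ^ 2) * 2 * (x * z - y ^ 2) * (x' * z'' + z' * x'' - 2 * (y' * y'')) - 2 * (a * c - b ^ 2) * 2 * (a' * c' - b' ^ 2) * (x * z'' + z * x'' - 2 * (y * y'')) * (x * z' + z * x' - 2 * (y * y')) - 2 * (a * c - b ^ 2) * (a' * z + c' * x - 2 * (b' * y)) * (a' * z + c' * x - 2 * (b' * y)) * (x' * z'' + z' * x'' - 2 * (y' * y'')) + 2 * (a * c - b ^ 2) * (a' * z + c' * x - 2 * (b' * y)) * (x * z'' + z * x'' - 2 * (y * y'')) * (a' * z' + c' * x' - 2 * (b' * y')) + 2 * (a * c - b ^ 2) * (a' * z'' + c' * x'' - 2 * (b' * y'')) * (a' * z + c' * x - 2 * (b'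 * y)) * (x * z' + z * x' - 2 * (y * y')) - 2 * (a * c - b ^ 2) * (a' * z'' + c' * x'' - 2 * (b' * y'')) * 2 * (x * z - y ^ 2) * (a' * z' + c' * x' - 2 * (b' * y')) - (a * c' + c * a' - 2 * (b * b')) * (a * c' + c * a' - 2 * (b * b')) * 2 * (x * z - y ^ 2) * (x' * z'' + z' * x'' - 2 * (y' * y'')) + (a * c' + c * a' - 2 * (b * b')) * (a * c' + c * a' - 2 * (b * b')) * (x * z'' + z * x'' - 2 * (y * y'')) * (x * z' + z * x' - 2 * (y * y')) + (a * c' + c * a' - 2 * (b * b')) * (a' * z + c' * x - 2 * (b' * y)) * (a * z + c * x - 2 * (b * y)) * (x' * z'' + z' * x'' - 2 * (y' * y'')) - (a * c' + c * a' - 2 * (b * b')) * (a' * z + c' * x - 2 * (b' * y)) * (x * z'' + z * x'' - 2 * (y * y'')) * (a * z' + c * x' - 2 * (b * y')) - (a * c' + c * a' - 2 * (b * b')) * (a' * z'' + c' * x'' - 2 * (b' * y'')) * (a * z + c * x - 2 * (b * y)) * (x * z' + z * x' - 2 * (y * y')) + (a * c' + c * a' - 2 * (b * b')) * (a' * z''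 + c' * x'' - 2 * (b' * y'')) * 2 * (x * z - y ^ 2) * (a * z' + c * x' - 2 * (b * y')) + (a * z + c * x - 2 * (b * y)) * (a * c' + c * a' - 2 * (b * b')) * (a' * z + c' * x - 2 * (b' * y)) * (x' * z'' + z' * x'' - 2 * (y' * y'')) - (a * z + c * x - 2 * (b * y)) * (a * c' + c * a' - 2 * (b * b')) * (x * z'' + z * x'' - 2 * (y * y'')) * (a' * z' + c' * x' - 2 * (b' * y')) - (a * z + c * x - 2 * (b * y)) * 2 * (a' * c' - b' ^ 2) * (a * z + c * x - 2 * (b * y)) * (x' * z'' + z' * x'' - 2 * (y' * y'')) + (a * z + c * x - 2 * (b * y)) * 2 * (a' * c' - b' ^ 2) * (x * z'' + z * x'' - 2 * (y * y'')) * (a * z' + c * x' - 2 * (b * y')) + (a * z + c * x - 2 * (b * y)) * (a' * z'' + c' * x'' - 2 * (b' * y'')) * (a * z + c * x - 2 * (b * y)) * (a' * z' + c' * x' - 2 * (b' * y')) - (a * z + c * x - 2 * (b * y)) * (a' * z'' + c' * x'' - 2 * (b' * y'')) * (a' * z + c' * x - 2 * (b' * y)) * (a * z' + c * x' - 2 *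 (b * y')) - (a * z'' + c * x'' - 2 * (b * y'')) * (a * c' + c * a' - 2 * (b * b')) * (a' * z + c' * x - 2 * (b' * y)) * (x * z' + z * x' - 2 * (y * y')) + (a * z'' + c * x'' - 2 * (b * y'')) * (a * c' + c * a' - 2 * (b * b')) * 2 * (x * z - y ^ 2) * (a' * z' + c' * x' - 2 * (b' * y')) + (a * z'' + c * x'' - 2 * (b * y'')) * 2 * (a' * c' - b' ^ 2) * (a * z + c * x - 2 * (b * y)) * (x * z' + z * x' - 2 * (y * y')) - (a * z'' + c * x'' - 2 * (b * y'')) * 2 * (a' * c' - b' ^ 2) * 2 * (x * z - y ^ 2) * (a * z' + c * x' - 2 * (b * y')) - (a * z'' + c * x'' - 2 * (b * y'')) * (a' * z + c' * x - 2 * (b' * y)) * (a * z + c * x - 2 * (b * y)) * (a' * z' + c' * x' - 2 * (b' * y')) + (a * z'' + c * x'' - 2 * (b * y'')) * (a' * z + c' * x - 2 * (b' * y)) * (a' * z + c' * x - 2 * (b' * y)) * (a * z' + c * x' - 2 * (b * y')) = 0 := by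
  ring

/-- **END-PAIR RESIDUAL IDENTITY (product form): `W_ij · W_ik = −2 U_i · W_jk`** for any five real symmetric `2 × 2` letters — the rank-one SIGN
coherence of the residual Gram `−s sᵀ` after the `{P,Q}` block (with `endPair_residual_sq`: `W_ij = −2 s_i s_j`, `U_i = s_i²·(−D)…` up to the common
positive factor; in particular `W_ij W_jk W_ik = −2 U_i W_jk² ≤ 0` whenever `U_i ≥ 0`). [folklore] -/
theorem endPair_residual_mul (a b c a' b' c' x y z x' y' z' x'' y'' z'' : ℝ) :
    (((a * c' + c * a' - 2 * (b * b')) ^ 2 - 4 * (a * c - b ^ 2) * (a' * c' - b' ^ 2)) * (x * z' + z * x' - 2 * (y * y')) + 2 * (a' * c' - b' ^ 2) * (a * z + c * x - 2 * (b * y)) * (a * z' + c * x' - 2 * (b * y')) - (a * c' + c * a' - 2 * (b * b')) * ((a * z + c * x - 2 * (b * y)) * (a' * z' + c' * x' - 2 * (b' * y')) + (a' * z + c' * x - 2 * (b' * y)) * (a * z' + c * x' - 2 * (b * y'))) + 2 * (a * c - b ^ 2) * (a' * z + c' * x - 2 * (b' * y)) * (a' * z' + c' * x' - 2 * (b' *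 y'))) * (((a * c' + c * a' - 2 * (b * b')) ^ 2 - 4 * (a * c - b ^ 2) * (a' * c' - b' ^ 2)) * (x * z'' + z * x'' - 2 * (y * y'')) + 2 * (a' * c' - b' ^ 2) * (a * z + c * x - 2 * (b * y)) * (a * z'' + c * x'' - 2 * (b * y'')) - (a * c' + c * a' - 2 * (b * b')) * ((a * z + c * x - 2 * (b * y)) * (a' * z'' + c' * x'' - 2 * (b' * y'')) + (a' * z + c' * x - 2 * (b' * y)) * (a * z'' + c * x'' - 2 * (b * y''))) + 2 * (a * c - b ^ 2) * (a' * z + c' * x - 2 * (b' * y)) * (a' * z'' + c' * x'' - 2 * (b' * y'')))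
    = -2 * (4 * (a * c - b ^ 2) * (a' * c' - b' ^ 2) * (x * z - y ^ 2) + (a * c' + c * a' - 2 * (b * b')) * (a' * z + c' * x - 2 * (b' * y)) * (a * z + c * x - 2 * (b * y)) - (a * c - b ^ 2) * (a' * z + c' * x - 2 * (b' * y)) ^ 2 - (a' * c' - b' ^ 2) * (a * z + c * x - 2 * (b * y)) ^ 2 - (x * z - y ^ 2) * (a * c' + c * a' - 2 * (b * b')) ^ 2) * (((a * c' + c * a' - 2 * (b * b')) ^ 2 - 4 * (a * c - b ^ 2) * (a' * c' - b' ^ 2)) * (x' * z'' + z' * x'' - 2 * (y' * y'')) + 2 * (a' * c' - b' ^ 2) * (a * z' + c * x' - 2 * (b * y')) * (a * z'' + c * x'' - 2 * (b * y'')) - (a * c' + c * a' - 2 * (b * b')) * ((a * z' + c * x' - 2 * (b * y')) * (a' * z'' + c' * x'' - 2 * (b' * y'')) + (a' * z' + c' * x' - 2 * (b' * y')) * (a * z'' + c * x'' - 2 * (b * y''))) + 2 * (a * c - b ^ 2) * (a' * z' + c' * x' - 2 * (b' * y')) * (a' * z'' + c' * x'' - 2 * (b' * y''))) := by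
  have h := gram_five_schur_identity (a * c - b ^ 2) (a' * c' - b' ^ 2) (x * z - y ^ 2) (a * c' + c * a' - 2 * (b * b')) (a * z + c * x - 2 * (b * y)) (a * z' + c * x' - 2 * (b * y')) (a * z'' + c * x'' - 2 * (b * y'')) (a' * z + c' * x - 2 * (b' * y)) (a' * z' + c' * x' - 2 * (b' * y')) (a' * z'' + c' * x'' - 2 * (b' * y'')) (x * z' + z * x' - 2 * (y * y')) (x * z'' + z * x'' - 2 * (y * y'')) (x' * z'' + z' * x'' - 2 * (y' * y''))
  rw [gram_five_minor_eq_zero, mul_zero] at h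
  linarith

/-- **Triangle sign of the residuals: `W_ij · W_jk · W_ik ≤ 0`** for any five… (here: four non-pair letters are not needed — three suffice) real
symmetric `2 × 2` letters `P, Q, S_i, S_j, S_k`: by `endPair_residual_mul`, `W_ij W_ik W_jk = −2 U_i W_jk²` and `U_i ≥ 0` is the G3 square
(`gram_three_eq_sq`).  This is the exact «odd-triangle»-type sign rule of the residual Gram. [folklore] -/
theorem endPair_residual_triangle_nonpos (a b c a' b' c' x y z x' y' z' x'' y'' z'' : ℝ) :
    (((a * c' + c * a' - 2 * (b * b')) ^ 2 - 4 * (a * c - b ^ 2) * (a' * c' - b' ^ 2)) * (x * z' + z * x' - 2 * (y * y')) + 2 * (a' * c' - b' ^ 2) * (a * z + c * x - 2 * (b * y)) * (a * z' + c * x' - 2 * (b * y')) - (a * c' + c * a' - 2 * (b * b')) * ((a * z + c * x - 2 * (b * y)) * (a' * z' + c' * x' - 2 * (b' * y')) + (a' * z + c' * x - 2 * (b' * y)) * (a * z' + c * x' - 2 * (b * y'))) + 2 * (a * c - b ^ 2) * (a' * z + c' * x - 2 * (b' * y)) * (a' * z' + c' * x' - 2 * (b' * y'))) * (((a * c' +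 c * a' - 2 * (b * b')) ^ 2 - 4 * (a * c - b ^ 2) * (a' * c' - b' ^ 2)) * (x * z'' + z * x'' - 2 * (y * y'')) + 2 * (a' * c' - b' ^ 2) * (a * z + c * x - 2 * (b * y)) * (a * z'' + c * x'' - 2 * (b * y'')) - (a * c' + c * a' - 2 * (b * b')) * ((a * z + c * x - 2 * (b * y)) * (a' * z'' + c' * x'' - 2 * (b' * y'')) + (a' * z + c' * x - 2 * (b' * y)) * (a * z'' + c * x'' - 2 * (b * y''))) + 2 * (a * c - b ^ 2) * (a' * z + c' * x - 2 * (b' * y)) * (a' * z'' + c' * x'' - 2 * (b' * y''))) * (((a * c' + c * a' - 2 * (b * b')) ^ 2 - 4 * (a * c - b ^ 2) * (a' * c' - b' ^ 2)) * (x' * z'' + z' * x'' - 2 * (y' * y'')) + 2 * (a' * c' - b' ^ 2) * (a * z' + c * x' - 2 * (b * y')) * (a * z'' + c * x'' - 2 * (b * y'')) - (a * c' + c * a' - 2 * (b * b')) * ((a * z' + c * x' - 2 * (b * y')) * (a' * z'' + c' * x'' - 2 * (b' * y'')) + (a' * z' + c' * x' - 2 * (b' * y')) * (a * z'' + c * x''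 - 2 * (b * y''))) + 2 * (a * c - b ^ 2) * (a' * z' + c' * x' - 2 * (b' * y')) * (a' * z'' + c' * x'' - 2 * (b' * y''))) ≤ 0 := by
  have hU : 0 ≤ (4 * (a * c - b ^ 2) * (a' * c' - b' ^ 2) * (x * z - y ^ 2) + (a * c' + c * a' - 2 * (b * b')) * (a' * z + c' * x - 2 * (b' * y)) * (a * z + c * x - 2 * (b * y)) - (a * c - b ^ 2) * (a' * z + c' * x - 2 * (b' * y)) ^ 2 - (a' * c' - b' ^ 2) * (a * z + c * x - 2 * (b * y)) ^ 2 - (x * z - y ^ 2) * (a * c' + c * a' - 2 * (b * b')) ^ 2) := by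
    rw [gram_three_eq_sq]; positivity
  have h := endPair_residual_mul a b c a' b' c' x y z x' y' z' x'' y'' z''
  generalize (4 * (a * c - b ^ 2) * (a' * c' - b' ^ 2) * (x * z - y ^ 2) + (a * c' + c * a' - 2 * (b * b')) * (a' * z + c' * x - 2 * (b' * y)) * (a * z + c * x - 2 * (b * y)) - (a * c - b ^ 2) * (a' * z + c' * x - 2 * (b' * y)) ^ 2 - (a' * c' - b' ^ 2) * (a * z + c * x - 2 * (b * y)) ^ 2 - (x * z - y ^ 2) * (a * c' + c * a' - 2 * (b * b')) ^ 2) = U at hU h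
  generalize (((a * c' + c * a' - 2 * (b * b')) ^ 2 - 4 * (a * c - b ^ 2) * (a' * c' - b' ^ 2)) * (x * z' + z * x' - 2 * (y * y')) + 2 * (a' * c' - b' ^ 2) * (a * z + c * x - 2 * (b * y)) * (a * z' + c * x' - 2 * (b * y')) - (a * c' + c * a' - 2 * (b * b')) * ((a * z + c * x - 2 * (b * y)) * (a' * z' + c' * x' - 2 * (b' * y')) + (a' * z + c' * x - 2 * (b' * y)) * (a * z' + c * x' - 2 * (b * y'))) + 2 * (a * c - b ^ 2) * (a' * z + c' * x - 2 * (b' * y)) * (a' * z' + c' * x' - 2 * (b' * y'))) = Wij at h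
  generalize (((a * c' + c * a' - 2 * (b * b')) ^ 2 - 4 * (a * c - b ^ 2) * (a' * c' - b' ^ 2)) * (x * z'' + z * x'' - 2 * (y * y'')) + 2 * (a' * c' - b' ^ 2) * (a * z + c * x - 2 * (b * y)) * (a * z'' + c * x'' - 2 * (b * y'')) - (a * c' + c * a' - 2 * (b * b')) * ((a * z + c * x - 2 * (b * y)) * (a' * z'' + c' * x'' - 2 * (b' * y'')) + (a' * z + c' * x - 2 * (b' * y)) * (a * z'' + c * x'' - 2 * (b * y''))) + 2 * (a * c - b ^ 2) * (a' * z + c' * x - 2 * (b' * y)) * (a' * z'' + c' * x'' - 2 * (b' * y''))) = Wik at h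
  generalize (((a * c' + c * a' - 2 * (b * b')) ^ 2 - 4 * (a * c - b ^ 2) * (a' * c' - b' ^ 2)) * (x' * z'' + z' * x'' - 2 * (y' * y'')) + 2 * (a' * c' - b' ^ 2) * (a * z' + c * x' - 2 * (b * y')) * (a * z'' + c * x'' - 2 * (b * y'')) - (a * c' + c * a' - 2 * (b * b')) * ((a * z' + c * x' - 2 * (b * y')) * (a' * z'' + c' * x'' - 2 * (b' * y'')) + (a' * z' + c' * x' - 2 * (b' * y')) * (a * z'' + c * x'' - 2 * (b * y''))) + 2 * (a * c - b ^ 2) * (a' * z' + c' * x' - 2 * (b' * y')) * (a' * z'' + c' * x'' - 2 * (b' * y''))) = Wjk at h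
  have e : Wij * Wik * Wjk = -2 * (U * Wjk ^ 2) := by rw [h]; ring
  rw [e]
  nlinarith [mul_nonneg hU (sq_nonneg Wjk)]

end Summit.ValiantsHypothesis.ValiantsHypothesis.Theorems.LacunarySymmetroidMatrixDescartes.Census
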